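import Mathlib

/-!
# Colour-cell universality: the block blow-up `𝔖ₘ ↪ 𝔖ₘₛ`
# (stub `colourSeparated_blowup` of crux `LevelGradedCohnUmans.GradedDesignFamily`)

Crux `stmt-MatrixMultiplication-7610`
(`Summit.MatrixMultiplication.MatrixMultiplication.Theses.LevelGradedCohnUmans.GradedDesignFamily`),
line `schur-weyl-colour-cells`, registered stub `colourSeparated_blowup` (colour-cell universality,
`Cruxes/GradedDesignFamily/Lines/schur-weyl-colour-cells-architecture.md` §2(c)).

For `r` colours and the symmetric group `𝔖ₘ = Equiv.Perm (Fin m)` the *colour cell*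
`J_r(m) ≤ ℂ^{𝔖ₘ}` is the span of the colouring-incidence tests `g ↦ [c' ∘ g = c]`,
`c c' : Fin m → Fin r`.  A triple `X, Y, Z ⊆ 𝔖ₘ` is `J`-separated if for every target
`(x₀, z₀) ∈ X × Z` some `f ∈ J` is `1` at the target products `x₀⁻¹ y y⁻¹ z₀` and `0` at every
other product `x⁻¹ y y'⁻¹ z` (`x ∈ X`, `y y' ∈ Y`, `z ∈ Z`).

**Statement (`colourSeparated_blowup`).** If `1 ≤ s`, `r ≤ 2 ^ s` and `(X, Y, Z)` is
`J_r(m)`-separated, then there is an injective group homomorphism `ι : 𝔖ₘ →* 𝔖ₘₛ` such that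
`(ι X, ι Y, ι Z)` is `J_2(ms)`-separated.

**Proof (explicit and elementary).**  Identify `Fin (m * s)` with `Fin m × Fin s`
(`finProdFinEquiv`) and let `ι g` act as `g` on the first coordinate — each point is blown up to
a block of `s` points and the blocks are permuted in parallel: `ι g (i, j) = (g i, j)`
(`Equiv.permCongr`, `Equiv.prodCongr g (Equiv.refl _)`).  This is a homomorphism, injective
because `s ≥ 1`.  Encode the `r ≤ 2 ^ s` colours injectively by binary words
`enc : Fin r ↪ (Fin s → Fin 2)` and lift an `r`-colouring `c` of `Fin m` to the `2`-colouring
`ĉ (i, j) = enc (c i) j` of `Fin m × Fin s`.  Then `ĉ' ∘ ι g = ĉ ↔ c' ∘ g = c` (compare block by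
block and use the injectivity of `enc`; `csb_lift_comp_eq_iff`), so the two-colour test
`[ĉ' ∘ h = ĉ]` restricts along `ι` to the `r`-colour test `[c' ∘ g = c]`; by linearity every
`f ∈ J_r(m)` is a restriction `F ∘ ι` with `F ∈ J_2(ms)` (`csb_span_transfer`).  Since `ι` is an
injective homomorphism, `F` at a product of images is `f` at the product and the target
condition is unchanged, so separation transfers verbatim (`csb_sep_transfer`).

Supports item `stmt-MatrixMultiplication-7610`; theorems only, no definitions.
-/

-- `Summit.<Summit>.<Problem>` is the tree's mandated summit-side namespace; for this
-- single-conjunct summit the two coincide, so the file silences `dupNamespace`.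
set_option linter.dupNamespace false

namespace Summit.MatrixMultiplication.MatrixMultiplication.Theorems.GradedDesignFamily.ElementaryBlowup

/-! ## Lifting colourings along a block blow-up -/

/-- Block-by-block comparison of lifted colourings.  Let `e : α × β ≃ P` present `P` as blocks
`{a} × β`, let `enc : κ → β → E` be an injective encoding of colours by words, and lift a colouring
`c : α → κ` to `ĉ p = enc (c (e⁻¹ p).1) (e⁻¹ p).2`.  If `G : P → P` acts blockwise as `g : α → α`
(`G (e (a, b)) = e (g a, b)`), then `ĉ' ∘ G = ĉ ↔ c' ∘ g = c`. -/
theorem csb_lift_comp_eq_iff {α β κ E P : Type*} (e : α × β ≃ P) (enc : κ → β → E)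
    (henc : Function.Injective enc) (c c' : α → κ) (g : α → α) (G : P → P)
    (hG : ∀ a b, G (e (a, b)) = e (g a, b)) :
    (fun p => enc (c' (e.symm p).1) (e.symm p).2) ∘ G =
        (fun p => enc (c (e.symm p).1) (e.symm p).2) ↔ c' ∘ g = c := by
  constructor
  · intro h
    funext a
    apply henc
    funext b
    have := congrFun h (e (a, b))
    simpa [hG] using this
  · intro h
    funext p
    obtain ⟨⟨a, b⟩, rfl⟩ := e.surjective p
    have hc : c' (g a) = c a := congrFun h a
    simp [hG, hc]

/-! ## Transfer of test functions and of separation along an injective homomorphism -/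

/-- If every generator `f ∈ S` is a restriction `F ∘ ι` of some `F ∈ T`, then every element of
`span S` is a restriction of some element of `span T` (restriction along `ι` is linear). -/
theorem csb_span_transfer {G H : Type*} (ι : G → H) (S : Set (G → ℂ)) (T : Set (H → ℂ))
    (hST : ∀ f ∈ S, ∃ F ∈ T, ∀ g, F (ι g) = f g) :
    ∀ f ∈ Submodule.span ℂ S, ∃ F ∈ Submodule.span ℂ T, ∀ g, F (ι g) = f g := by
  intro f hf
  have hle : Submodule.span ℂ S ≤ (Submodule.span ℂ T).map (LinearMap.funLeft ℂ ℂ ι) := by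
    rw [Submodule.span_le]
    intro f hf
    obtain ⟨F, hF, hFf⟩ := hST f hf
    refine ⟨F, Submodule.subset_span hF, ?_⟩
    funext g
    rw [LinearMap.funLeft_apply]
    exact hFf g
  obtain ⟨F, hF, hFf⟩ := Submodule.mem_map.1 (hle hf)
  refine ⟨F, hF, fun g => ?_⟩
  rw [← hFf, LinearMap.funLeft_apply]

/-- Separation transfers along an injective group homomorphism `ι : G →* H`: if every test
function of `J` is a restriction `F ∘ ι` of a test function `F ∈ J'`, then a `J`-separated triple
`(X, Y, Z)` in `G` has a `J'`-separated image `(ι X, ι Y, ι Z)` in `H` (products of images are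
images of products, and the target condition is unchanged by injectivity). -/
theorem csb_sep_transfer {G H : Type*} [Group G] [Group H] [DecidableEq H] (ι : G →* H)
    (hinj : Function.Injective ι) (J : Submodule ℂ (G → ℂ)) (J' : Submodule ℂ (H → ℂ))
    (hJ : ∀ f ∈ J, ∃ F ∈ J', ∀ g, F (ι g) = f g) (X Y Z : Finset G)
    (hsep : ∀ x₀ ∈ X, ∀ z₀ ∈ Z, ∃ f ∈ J, ∀ x ∈ X, ∀ y ∈ Y, ∀ y' ∈ Y, ∀ z ∈ Z,
      (x = x₀ ∧ y = y' ∧ z = z₀ → f (x⁻¹ * y * y'⁻¹ * z) = 1) ∧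
        (¬ (x = x₀ ∧ y = y' ∧ z = z₀) → f (x⁻¹ * y * y'⁻¹ * z) = 0)) :
    ∀ x₀ ∈ X.image ι, ∀ z₀ ∈ Z.image ι, ∃ f ∈ J', ∀ x ∈ X.image ι, ∀ y ∈ Y.image ι,
      ∀ y' ∈ Y.image ι, ∀ z ∈ Z.image ι,
        (x = x₀ ∧ y = y' ∧ z = z₀ → f (x⁻¹ * y * y'⁻¹ * z) = 1) ∧
          (¬ (x = x₀ ∧ y = y' ∧ z = z₀) → f (x⁻¹ * y * y'⁻¹ * z) = 0) := by
  intro x₀' hx₀' z₀' hz₀'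
  obtain ⟨x₀, hx₀, rfl⟩ := Finset.mem_image.1 hx₀'
  obtain ⟨z₀, hz₀, rfl⟩ := Finset.mem_image.1 hz₀'
  obtain ⟨f, hf, hfsep⟩ := hsep x₀ hx₀ z₀ hz₀
  obtain ⟨F, hF, hFf⟩ := hJ f hf
  refine ⟨F, hF, ?_⟩
  intro x' hx' y' hy' y'' hy'' z' hz'
  obtain ⟨x, hx, rfl⟩ := Finset.mem_image.1 hx'
  obtain ⟨y, hy, rfl⟩ := Finset.mem_image.1 hy'
  obtain ⟨y₁, hy₁, rfl⟩ := Finset.mem_image.1 hy''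
  obtain ⟨z, hz, rfl⟩ := Finset.mem_image.1 hz'
  have hprod : (ι x)⁻¹ * ι y * (ι y₁)⁻¹ * ι z = ι (x⁻¹ * y * y₁⁻¹ * z) := by
    simp only [map_mul, map_inv]
  have hval : F ((ι x)⁻¹ * ι y * (ι y₁)⁻¹ * ι z) = f (x⁻¹ * y * y₁⁻¹ * z) := by
    rw [hprod, hFf]
  have hiff : (ι x = ι x₀ ∧ ι y = ι y₁ ∧ ι z = ι z₀) ↔ (x = x₀ ∧ y = y₁ ∧ z = z₀) := by
    rw [hinj.eq_iff, hinj.eq_iff, hinj.eq_iff]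
  rw [hval, hiff]
  exact hfsep x hx y hy y₁ hy₁ z hz

/-! ## The stub -/

/-- **Colour-cell universality** (registered stub `colourSeparated_blowup` of crux
`LevelGradedCohnUmans.GradedDesignFamily`, line `schur-weyl-colour-cells`).  If `1 ≤ s`,
`r ≤ 2 ^ s`, and `X, Y, Z ⊆ 𝔖ₘ` are separated by the `r`-colour cell (the span of the tests
`g ↦ [c' ∘ g = c]`, `c c' : Fin m → Fin r`), then the block blow-up `ι : 𝔖ₘ →* 𝔖ₘₛ`
(`ι g (i, j) = (g i, j)` under `Fin (m * s) ≃ Fin m × Fin s`) is an injective homomorphism and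
`ι X, ι Y, ι Z ⊆ 𝔖ₘₛ` are separated by the two-colour cell.  Proof: binary-encode the colours
(`Fin r ↪ (Fin s → Fin 2)`), lift colourings blockwise, and transfer
(`csb_lift_comp_eq_iff`, `csb_span_transfer`, `csb_sep_transfer`). -/
theorem colourSeparated_blowup (m s r : ℕ) (hs : 1 ≤ s) (hr : r ≤ 2 ^ s) (X Y Z : Finset (Equiv.Perm (Fin m))) (hsep : ∀ x₀ ∈ X, ∀ z₀ ∈ Z, ∃ f ∈ Submodule.span ℂ {f : Equiv.Perm (Fin m) → ℂ | ∃ c c' : Fin m → Fin r, f = fun g : Equiv.Perm (Fin m) => if c' ∘ (⇑g) = c then (1 : ℂ) else 0}, ∀ x ∈ X, ∀ y ∈ Y, ∀ y' ∈ Y, ∀ z ∈ Z, (x = x₀ ∧ y = y' ∧ z = z₀ → f (x⁻¹ * y * y'⁻¹ * z) = 1) ∧ (¬ (x = x₀ ∧ y = y' ∧ z = z₀) → f (x⁻¹ * y * y'⁻¹ * z) = 0)) : ∃ ι : Equiv.Perm (Fin m) →* Equiv.Perm (Fin (m * s)), Function.Injective ι ∧ ∀ x₀ ∈ X.image ι,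 ∀ z₀ ∈ Z.image ι, ∃ f ∈ Submodule.span ℂ {f : Equiv.Perm (Fin (m * s)) → ℂ | ∃ c c' : Fin (m * s) → Fin 2, f = fun g : Equiv.Perm (Fin (m * s)) => if c' ∘ (⇑g) = c then (1 : ℂ) else 0}, ∀ x ∈ X.image ι, ∀ y ∈ Y.image ι, ∀ y' ∈ Y.image ι, ∀ z ∈ Z.image ι, (x = x₀ ∧ y = y' ∧ z = z₀ → f (x⁻¹ * y * y'⁻¹ * z) = 1) ∧ (¬ (x = x₀ ∧ y = y' ∧ z = z₀) → f (x⁻¹ * y * y'⁻¹ * z) = 0) := by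
  -- the blocks: `Fin (m * s) ≃ Fin m × Fin s`
  obtain ⟨e⟩ : Nonempty (Fin m × Fin s ≃ Fin (m * s)) := ⟨finProdFinEquiv⟩
  -- binary encoding of the `r ≤ 2 ^ s` colours
  obtain ⟨enc, henc⟩ : ∃ enc : Fin r → Fin s → Fin 2, Function.Injective enc := by
    have hcard : Fintype.card (Fin r) ≤ Fintype.card (Fin s → Fin 2) := by
      simpa only [Fintype.card_fun, Fintype.card_fin] using hr
    obtain ⟨emb⟩ := Function.Embedding.nonempty_of_card_le hcard
    exact ⟨emb, emb.injective⟩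
  -- the block blow-up `ι g (i, j) = (g i, j)`, an injective homomorphism since `s ≥ 1`
  obtain ⟨ι, hinj, hι⟩ : ∃ ι : Equiv.Perm (Fin m) →* Equiv.Perm (Fin (m * s)),
      Function.Injective ι ∧ ∀ g i j, ι g (e (i, j)) = e (g i, j) := by
    refine ⟨MonoidHom.mk' (fun g => e.permCongr (Equiv.prodCongr g (Equiv.refl (Fin s)))) ?_,
      ?_, ?_⟩
    · intro g h
      rw [← Equiv.permCongr_mul]
      congr 1
    · intro g h hgh
      refine Equiv.ext fun i => ?_
      have := Equiv.congr_fun hgh (e (i, ⟨0, hs⟩))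
      simpa using this
    · intro g i j
      simp
  refine ⟨ι, hinj, csb_sep_transfer ι hinj _ _ ?_ X Y Z hsep⟩
  -- every `r`-colour test is the restriction along `ι` of a two-colour test
  refine csb_span_transfer ι _ _ ?_
  rintro f ⟨c, c', rfl⟩
  refine ⟨_, ⟨fun p => enc (c (e.symm p).1) (e.symm p).2,
    fun p => enc (c' (e.symm p).1) (e.symm p).2, rfl⟩, fun g => ?_⟩
  exact if_congr (csb_lift_comp_eq_iff e enc henc c c' g (ι g) (hι g)) rfl rfl

end Summit.MatrixMultiplication.MatrixMultiplication.Theorems.GradedDesignFamily.ElementaryBlowup
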